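import Summits.QuantumFields.BalabanUV.T4Continuum.Support.NE7EnergyRateWSU2
import Summits.QuantumFields.BalabanUV.T4Continuum.Support.NE7AllMinimisersSmallSU2
import HarnessLib

/-!
# NE7EnergyRateWSU2End — T-E_w♯ IN THE CURRENCY OF ROUTE 1's END (`Regular … ε g`, the small data): for SU(2), d = 4, L = 2, `0 < ε ≤ ε₀`, `0 < g` there are k-free, N-free `C, s ≥ 0`
# such that for every period `N` there is `δ_V > 0` with `NE3EnergyRateWSup 4 (sfClass 4 2 N ε) 2 N ε g C s dom` for EVERY data class `dom` inside the small data of radius `δ_V` — the rate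
# conjunct and the sup conjunct of the background∕one-step socket `h` of `NE7Route1EndDockedSmallDataSU2`, for EVERY minimiser pair the END reads

Cell `pub-balaban`, rung (B)+1 sub-cell t4, lineage `b2b-balaban-t4-ne7-p1`, generation 105 (CRUX PROVER NE7 #1 = OWNER of BINDER row NE7).  Memo `t4/b2b-balaban-t4-ne7-p1-g105/ROAD-G105.md` §5.
WHY.  `NE7EnergyRateWSU2.ne3EnergyRateWSup_SU2` (this generation) asks the regularity radius `b` of the finer minimiser to satisfy `b + 10⁸b² ≤ ε` (so that its block average is an admissible
competitor of the coarser problem); the END `NE7Route1EndDockedSmallDataSU2` reads minimiser pairs with `Regular 4 L N ε g (k+1) U_B` (`b = ε`, from (H∃)ᴱ).  (8)∀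
(`NE7AllMinimisersSmallSU2.all_minimisers_small_SU2`, this generation) closes the gap: over the small data EVERY minimiser of the `ε`-class is `SmallField ((ε∕4)∕M²)`, so it is
`Regular 4 2 N (ε∕4) g`, T-E_w♯ applies with `b = ε∕4`, and `residualScale` is monotone in `b`.
WHAT ([folklore]; 0 def, 0 sorry).  §1 `residualScale_mono_b`; §2 **`ne3EnergyRateWSup_SU2_smallData`**: `card n = 2 → ∃ ε₀ > 0, ∀ 0 < ε ≤ ε₀, ∀ g > 0, ∃ C s ≥ 0, ∀ N ≥ 1, ∃ δ_V > 0, ∀ dom ⊆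
{V | unitary, N-periodic, SmallField V δ_V}, NE3EnergyRateWSup 4 (sfClass 4 2 N ε) 2 N ε g C s dom`.
HONEST FRAMING (page 1): composition of this generation's two theorems; nothing of Bałaban's asserted; this discharges the RATE and SUP conjuncts of socket `h` for every minimiser pair of the END
but NOT its covariant-Lipschitz conjuncts (Lip₁ᶜ)(Lip₂′ᶜ) (regularity — open), so `h` itself stays displayed; NOT NE3∕NE7 as spine nodes; spine count = dagwriter∕referees' call; SU(2), `L = 2`,
finite 4-torus, constants existential; NOT infinite volume, NOT mass gap, NOT BetaPertH, NOT Clay (continuum YM on T⁴ ⇐ BetaPertH ∧ nine spine estimates).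
-/

set_option autoImplicit false

open scoped BigOperators Matrix Matrix.Norms.L2Operator
open NormedSpace Finset Set

namespace Summit.QuantumFields.BalabanUV.T4Continuum.NE7EnergyRateWSU2End

open Literature.MathematicalPhysics.QuantumFieldTheory.Balaban1983to89
open B7Prop1Explicit B7Prop2Explicit
open T4AveragingDeficitWall (IsUnitaryCfg IsSkewDir SmallField vary)
open T4AveragingDeficitWallBoundary (IsPeriodicCfg periodBox)
open AveragingDeficitPeriodicCounting (IsPeriodicDir)
open AveragingDeficitDerivWallProof (wallConst wallConst_nonneg)
open AveragingDeficitDualResidual (dualC2 dualC1)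
open MinimalActionSandwich (IsMinimiser)
open MinimalActionRate (sfClass Regular)
open NE3EnergyShapes (IsUnitarySite IsPeriodicSite residualScale dualC1_nonneg dualC2_nonneg)
open NE3EnergyWeightedShapes (energyNormW energyNormW_nonneg)
open NE3EnergyWeightedSupShape (NE3EnergyRateWSup)
open NE7EnergyRateWSU2 (ne3EnergyRateWSup_SU2)
open NE7AllMinimisersSmallSU2 (all_minimisers_small_SU2)

noncomputable section

/-! ## §1 The residual scale is monotone in the regularity radius -/

/-- `0 ≤ b ≤ b′ ⟹ residualScale d L N b g k ≤ residualScale d L N b′ g k`. [folklore] -/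
theorem residualScale_mono_b (d L N k : ℕ) {b b' g : ℝ} (hb : 0 ≤ b) (hbb' : b ≤ b') :
    residualScale d L N b g k ≤ residualScale d L N b' g k := by
  unfold residualScale
  have hw := wallConst_nonneg d L
  have hd1 := dualC1_nonneg d L
  have hz : 0 ≤ (L : ℝ) ^ (4 - (d : ℤ)) := by positivity
  have hsq : (b / ((L : ℝ) ^ (k + 1)) ^ 2) ^ 2 ≤ (b' / ((L : ℝ) ^ (k + 1)) ^ 2) ^ 2 :=
    pow_le_pow_left₀ (by positivity) (div_le_div_of_nonneg_right hbb' (by positivity)) 2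
  have h2 : (b / ((L : ℝ) ^ (k + 1)) ^ 2) ^ 2 * dualC1 d L * Real.sqrt (d * ((N * L ^ k : ℕ) : ℝ) ^ d)
      ≤ (b' / ((L : ℝ) ^ (k + 1)) ^ 2) ^ 2 * dualC1 d L * Real.sqrt (d * ((N * L ^ k : ℕ) : ℝ) ^ d) :=
    mul_le_mul_of_nonneg_right (mul_le_mul_of_nonneg_right hsq hd1) (Real.sqrt_nonneg _)
  exact mul_le_mul_of_nonneg_left (by linarith) (mul_nonneg hz hw)

/-! ## §2 T-E_w♯ with `b = ε` over the small data -/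

variable {n : Type} [Fintype n] [DecidableEq n]

/-- **T-E_w♯ IN THE END's CURRENCY** (statement in the file header). [folklore] -/
theorem ne3EnergyRateWSup_SU2_smallData [Nonempty n] (hn : Fintype.card n = 2) :
    ∃ ε₀ : ℝ, 0 < ε₀ ∧ ∀ ε : ℝ, 0 < ε → ε ≤ ε₀ → ∀ g : ℝ, 0 < g →
      ∃ C s : ℝ, 0 ≤ C ∧ 0 ≤ s ∧ ∀ (N : ℕ) [NeZero N], 1 ≤ N → ∃ δV : ℝ, 0 < δV ∧
        ∀ dom : Set (Site 4 → Fin 4 → (Matrix n n ℂ)ˣ),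
          dom ⊆ {V : Site 4 → Fin 4 → (Matrix n n ℂ)ˣ | IsUnitaryCfg V ∧ IsPeriodicCfg V (N : ℤ) ∧ SmallField V δV} →
          NE3EnergyRateWSup 4 (sfClass 4 2 N ε) 2 N ε g C s dom := by
  obtain ⟨ε₁, hε₁, H1⟩ := ne3EnergyRateWSup_SU2 (n := n) hn
  obtain ⟨ε₂, hε₂, H2⟩ := all_minimisers_small_SU2 (n := n) hn
  refine ⟨min ε₁ (min ε₂ (1 / 10 ^ 8)), lt_min hε₁ (lt_min hε₂ (by norm_num)), ?_⟩
  intro ε hε hεle g hg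
  have hεε₁ : ε ≤ ε₁ := hεle.trans (min_le_left _ _)
  have hεε₂ : ε ≤ ε₂ := hεle.trans ((min_le_right _ _).trans (min_le_left _ _))
  have hε8 : ε ≤ 1 / 10 ^ 8 := hεle.trans ((min_le_right _ _).trans (min_le_right _ _))
  -- T-E_w♯ at `b = ε/4`: the line `ε/4 + 10⁸(ε/4)² ≤ ε`
  have hb : (0 : ℝ) ≤ ε / 4 := by positivity
  have hbq : ε / 4 + 10 ^ 8 * (ε / 4) ^ 2 ≤ ε := by nlinarith
  obtain ⟨C, s, hC, hs, HC⟩ := H1 ε hε hεε₁ (ε / 4) g hb hbq hg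
  refine ⟨C, s, hC, hs, fun N _ hN => ?_⟩
  obtain ⟨δV, hδV, Hsmall⟩ := H2 ε hε hεε₂ N hN
  refine ⟨δV, hδV, fun dom hdom => ?_⟩
  intro k hk V hV UA UB hA hB hreg
  -- every minimiser of the `ε`-class is `SmallField ((ε/4)/M²)`: `U_B` is `Regular (ε/4) g`
  have hsmallB := Hsmall V (hdom hV) (k + 1) UB hB
  have hreg' : Regular 4 2 N (ε / 4) g (k + 1) UB := ⟨hreg.unitary, hreg.periodic, hsmallB, hreg.grad⟩
  obtain ⟨u, Z, hu, huP, hZs, hZP, hgauge, hE, hsup⟩ := HC N dom k hk V hV UA UB hA hB hreg'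
  refine ⟨u, Z, hu, huP, hZs, hZP, hgauge, hE.trans (mul_le_mul_of_nonneg_left ?_ hC), hsup⟩
  exact residualScale_mono_b 4 2 N k hb (by linarith)

end

end Summit.QuantumFields.BalabanUV.T4Continuum.NE7EnergyRateWSU2End
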